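import Summits.QuantumFields.YangMills.Theorems.BalabanLadderROTDefs
import Summits.QuantumFields.YangMills.Theorems.LangevinControlUVOSLegsFromFemtoAndGapStubAssemblyLimit
import Summits.QuantumFields.YangMills.Theorems.LangevinControlUVOSLegsAtWeakCouplingCStubDensity
import HarnessLib

/-!
# Crux `ROT` (stmt-QuantumFields-20042), registered stub `stub_uvExtract : UVExtract` — UV extraction off the diagonal

Helper file (`--supports stmt-QuantumFields-20042`) of the fleet lead `ym-spine-20042-p1` for the line of record «King
split» (skeleton v3 `Cruxes/ROT/Lines/birth.lean`, ff3050db3a1215f0; stub vocabulary `Theorems/BalabanLadderROTDefs.lean`).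

**`theorem stub_uvExtract : UVExtract`** — for every compact simple `G`, every lattice representation `r`, every positive
unit map `a → 0`: the plane-resolved hyperscaling moment bounds `MomentBounds6 G r a` give UV sequential compactness off
the diagonal, `UVCompactAt r a` — every subsequence `φ → ∞` of every admissible scheme (`a_k = a(β_k)`, `β_k → ∞`, ranges
`a_k ≤ 1/24`, `14 ≤ L_k`, `a_k⁻² ≤ L_k`) has a further subsequence `φ ∘ ψ` along which the centred, `a⁻⁴`-renormalised
lattice `n`-point distributions (`n ≥ 2`) of the action density converge on ALL of `⁰𝒮` to a one-field family `S₁` with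
`S₁ 1 = 0` and bounded densities off the diagonal (`OffDiagDensity S₁`).

The proof is a composition of the landed `dlr-collar-transfer` toolkit of crux `OSLegsFromFemtoAndGap`:
* `momentBounds_of_momentBounds6` (toolkit IX): `MomentBounds6 ⇒ MomentBounds` by expanding `tr F² = Σ_q P^q`;
* `exists_subseq_latticeDist_limit` (toolkit VII = VI-c + II): in the regime `β ≥ β₄`, `0 < a ≤ min 1 ℓ₄`, `L ≥ 14`,
  `L ≥ a⁻²` the lattice distributions are bounded on `⁰𝒮ₙ` by `5Kⁿ‖·‖_{10n}` uniformly, so a diagonal subsequence plus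
  Hahn–Banach gives limits `S n` (`n ≥ 2`) with convergence on all of `⁰𝒮ₙ`; the regime holds along `φ` after a tail
  shift `k₀` (`β_{φ k} → ∞`, `a(β_{φ k}) → 0`, `a ≤ 1/24 ≤ 1`), and `ψ := φ₁(·) + k₀`;
* `offDiagDensity_of_tendsto_latticeDist` (this file) — the Riemann-sum argument of the landed `stub_density`
  (`Theorems/LangevinControlUVOSLegsAtWeakCouplingCStubDensity.lean`) run along an arbitrary sequence of lattices
  `(β_k, L_k, a_k)` in units `a` with `β_k → ∞`, `a_k → 0`, `a_k L_k → ∞` and the two torus ranges, its `SoftBundle`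
  hypothesis replaced by the five clauses it consumes: for compactly supported `δ`-separated `F` the collar radius
  `R` of `exists_collar_radius` for the lattice separation `δ/(2a_k) ≥ 6` gives `|W_k(x)| ≤ (Cκ⁴)ⁿ a_k^{4n}`
  (`κ = 24/δ + 2/ℓ₄ + 24`), and the Riemann sums `a_k^{4n} Σ_x ‖F(a_k x)‖ → ∫ ‖F‖` (`tendsto_riemann_sum`).
The family is `S₁ 0 := δ_default`, `S₁ 1 := 0`, `S₁ n := S n` (`n ≥ 2`).

Refs: Glimm–Jaffe 1987 §6.1 (lattice approximation, subsequential limits, Riemann sums); Osterwalder–Schrader 1973 §2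
(`⁰𝒮`); C. King, Commun. Math. Phys. 103 (1986) Thm 2.4 (where the compactness is consumed: `kingUpgrade`).  No
definition, no named fact, no sorry; standard axioms.  NOT a claim about rotation invariance or the mass gap: a
compactness statement about lattice Yang–Mills under the hyperscaling hypothesis `MomentBounds6`.
-/

set_option autoImplicit false

noncomputable section

open scoped SchwartzMap BigOperators
open MeasureTheory Filter Topology Metric
open Literature.MathematicalPhysics.QuantumFieldTheory Literature.MathematicalPhysics.QuantumLattice
open Literature.MathematicalPhysics.AQFT
open Literature.Probability.LatticeModels (box Site mem_box)
open Summit.QuantumFields.YangMills.Cruxes.OSLegsFromFemtoAndGap.DlrCollarTransfer (MomentBounds MomentBounds6)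
open Summit.QuantumFields.YangMills.Cruxes.OSLegsAtWeakCouplingC.Sketch (Separated OffDiagDensity tendsto_riemann_sum)
open Summit.QuantumFields.YangMills.Theorems.OSLegsFromFemtoAndGap
open Summit.QuantumFields.YangMills.Theorems.NPointIsotropy.Negative (E4)

namespace Summit.QuantumFields.YangMills.Theorems.ROT

variable {G : Type} [Group G] [TopologicalSpace G] [IsTopologicalGroup G] [CompactSpace G]
  [MeasurableSpace G] [BorelSpace G]

/-! ## Bounded densities of a sequential limit off the diagonal -/

/-- **Bounded densities off the diagonal for ANY sequential limit of the centred lattice distributions.**  Let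
`(β_k, L_k, a_k)` be lattices in units `a` (`a_k = a(β_k)`) with `β_k → ∞`, `0 < a_k → 0`, `a_k L_k → ∞` and the torus
ranges `14 ≤ L_k`, `a_k⁻² ≤ L_k`, and let `S₁` be a one-field family with `S₁ 0 = δ`, `S₁ 1 = 0` to which the centred,
`a⁻⁴`-renormalised lattice `n`-point distributions (`n ≥ 2`) of the action density converge on `⁰𝒮`.  Under
`MomentBounds6 G r a`, `S₁` has bounded densities off the big diagonal: `‖S₁ n F‖ ≤ (C κ⁴)ⁿ ∫ ‖F‖`
(`κ = 24/δ + 2/ℓ₄ + 24`) for compactly supported `F` with `tsupport F ⊆ Separated n δ` — the argument of the landed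
`stub_density` along an arbitrary sequence (collar bound at radius `R ≍ δ/a_k`, no wrap-around once `a_k L_k ≥ 2ρ`,
Riemann sums). [folklore; Glimm–Jaffe 1987 §6.1] -/
theorem offDiagDensity_of_tendsto_latticeDist (r : LatticeRep G) {a : ℝ → ℝ} (hMB6 : MomentBounds6 G r a)
    (as βs : ℕ → ℝ) (Ls : ℕ → ℕ) (hunits : ∀ k, as k = a (βs k)) (hβ : Tendsto βs atTop atTop)
    (hapos : ∀ k, 0 < as k) (ha0 : Tendsto as atTop (𝓝 0))
    (haL : Tendsto (fun k => as k * (Ls k : ℝ)) atTop atTop)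
    (hranges : ∀ k, 14 ≤ Ls k ∧ (as k)⁻¹ * (as k)⁻¹ ≤ Ls k)
    (S₁ : SchwingerFamily E4) (hS0 : ∀ F : 𝓢((Fin 0 → E4), ℂ), S₁ 0 F = F default)
    (hS1 : ∀ F : 𝓢((Fin 1 → E4), ℂ), S₁ 1 F = 0)
    (hconv : ∀ n, 2 ≤ n → ∀ F : 𝓢((Fin n → E4), ℂ), IsOffDiagonal F →
      Tendsto (fun k => latticeDist r.ρ (βs k) (Ls k) (as k) r.curvature.F
        (wilsonTorusMean r.ρ (βs k) (Ls k) r.curvature.F) n F) atTop (𝓝 (S₁ n F))) :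
    OffDiagDensity S₁ := by
  classical
  -- adapted from `Cruxes.OSLegsAtWeakCouplingC.Sketch.stub_density` (same toolkit, sequence form)
  intro n δ hδ
  rcases n with _ | _ | n
  · -- arity 0: `S₁ 0 F = F default` and the volume of the one-point space is a Dirac mass
    refine ⟨1, fun F _ _ => ?_⟩
    have hint : ∫ x : Fin 0 → EuclideanSpace ℝ (Fin 4), ‖F x‖ = ‖F default‖ := by
      rw [Measure.volume_pi_eq_dirac (default : Fin 0 → EuclideanSpace ℝ (Fin 4)), integral_dirac]
    rw [hS0, one_mul, hint]
  · -- arity 1: `S₁ 1 = 0`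
    refine ⟨0, fun F _ _ => ?_⟩
    rw [hS1, norm_zero, zero_mul]
  · -- arity `N = n + 2`
    obtain ⟨C, β₄, ℓ₄, hℓ, hC, H⟩ :=
      abs_torusMoment_le_of_momentBounds r (momentBounds_of_momentBounds6 r a hMB6)
    set N : ℕ := n + 1 + 1 with hN
    have hN2 : 2 ≤ N := by omega
    set κ : ℝ := 24 / δ + 2 / ℓ₄ + 24 with hκ
    have hκ0 : 0 < κ := by positivity
    refine ⟨(C * κ ^ 4) ^ N, fun F hFc hFs => ?_⟩
    -- `F` is off-diagonal: its support avoids the coincidence locus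
    have hFoff : IsOffDiagonal F := by
      refine IsOffDiagonal.of_tsupport_subset fun y hy hcoin => ?_
      obtain ⟨i, j, hij, hyij⟩ := (mem_coincidenceLocus y).1 hcoin
      have h : δ ≤ dist (y i) (y j) := hFs hy i j hij
      rw [hyij, dist_self] at h
      exact absurd h (not_le.2 hδ)
    -- a support radius
    obtain ⟨ρ, hρ0, hρ⟩ : ∃ ρ : ℝ, 0 ≤ ρ ∧ tsupport (F : (Fin N → EuclideanSpace ℝ (Fin 4)) → ℂ) ⊆
        closedBall (0 : Fin N → EuclideanSpace ℝ (Fin 4)) ρ := by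
      obtain ⟨ρ, hρ⟩ := hFc.isCompact.isBounded.subset_closedBall 0
      exact ⟨max ρ 0, le_max_right _ _, hρ.trans (closedBall_subset_closedBall (le_max_left _ _))⟩
    -- the two limits: lattice distributions → `S₁ N F`, Riemann sums → `∫ ‖F‖`
    have hlim : Tendsto (fun k => ‖latticeDist r.ρ (βs k) (Ls k) (as k) r.curvature.F
        (wilsonTorusMean r.ρ (βs k) (Ls k) r.curvature.F) N F‖) atTop (𝓝 ‖S₁ N F‖) :=
      (hconv N hN2 F hFoff).norm
    have hRiem : Tendsto (fun k => as k ^ (4 * N) *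
        ∑ x ∈ Fintype.piFinset (fun _ : Fin N => box 4 (Ls k)), ‖F (fun i => as k • siteToE (x i))‖)
        atTop (𝓝 (∫ y, ‖F y‖)) :=
      tendsto_riemann_sum (fun y => ‖F y‖) F.continuous.norm hFc.norm as Ls hapos ha0 haL
    -- eventual domination of the lattice distributions by the Riemann sums
    have hev : ∀ᶠ k in atTop, ‖latticeDist r.ρ (βs k) (Ls k) (as k) r.curvature.F
        (wilsonTorusMean r.ρ (βs k) (Ls k) r.curvature.F) N F‖ ≤
        (C * κ ^ 4) ^ N * (as k ^ (4 * N) *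
          ∑ x ∈ Fintype.piFinset (fun _ : Fin N => box 4 (Ls k)), ‖F (fun i => as k • siteToE (x i))‖) := by
      have hε : 0 < min (min 1 ℓ₄) (δ / 12) := lt_min (lt_min one_pos hℓ) (by positivity)
      filter_upwards [hβ.eventually_ge_atTop β₄, ha0.eventually (gt_mem_nhds hε),
        haL.eventually_ge_atTop (2 * ρ)] with k hkβ hka hkL
      have hak : 0 < as k := hapos k
      have ha1 : as k ≤ 1 := (hka.le.trans (min_le_left _ _)).trans (min_le_left _ _)
      have haℓ : as k ≤ ℓ₄ := (hka.le.trans (min_le_left _ _)).trans (min_le_right _ _)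
      have haδ : as k * 12 ≤ δ := by
        have := hka.le.trans (min_le_right _ _)
        rwa [le_div_iff₀ (by norm_num : (0 : ℝ) < 12)] at this
      obtain ⟨hL14, hLa⟩ := hranges k
      -- collar radius for the lattice separation `δ / (2 a_k) ≥ 6`
      have hδ6 : 6 ≤ δ / (2 * as k) := by
        rw [le_div_iff₀ (by positivity)]
        linarith
      obtain ⟨R, hR1, hRa, hRL, hRδ, hRinv⟩ := exists_collar_radius hδ6 hℓ hak ha1 haℓ hL14 hLa
      have hRpos : (0 : ℝ) < R := by exact_mod_cast hR1
      have hRinv' : (R : ℝ)⁻¹ ≤ as k * κ := by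
        have : 12 / (δ / (2 * as k)) + as k * (2 / ℓ₄ + 24) = as k * κ := by
          rw [hκ, div_div_eq_mul_div]
          ring
        rw [← this]
        exact hRinv
      -- the collar bound at the lattice multi-sites seen by `F`
      have hW : ∀ x : Fin N → Site 4, F (fun i => as k • siteToE (x i)) ≠ 0 →
          |torusMoment r.ρ (βs k) (Ls k) r.curvature.F
              (wilsonTorusMean r.ρ (βs k) (Ls k) r.curvature.F) x| ≤
            (C * κ ^ 4) ^ N * as k ^ (4 * N) := by
        intro x hx
        have hy : (fun i => as k • siteToE (x i)) ∈ tsupport (F : (Fin N → EuclideanSpace ℝ (Fin 4)) → ℂ) :=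
          subset_tsupport _ (Function.mem_support.2 hx)
        -- no wrap-around: all sites in the bulk of the torus
        have hwrap : ∀ i, 2 * ‖x i‖ ≤ (Ls k : ℝ) := by
          intro i
          have h1 := hρ hy
          rw [mem_closedBall, dist_zero_right] at h1
          have h2 : as k * ‖x i‖ ≤ ρ :=
            (mul_norm_le_norm_smul_siteToE hak.le (x i)).trans ((norm_le_pi_norm _ i).trans h1)
          have h3 : as k * (2 * ‖x i‖) ≤ as k * (Ls k : ℝ) := by linarith
          exact le_of_mul_le_mul_left h3 hak
        -- lattice sup-separation `≥ δ / (2 a_k) ≥ 2R + 4`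
        have hsepx : ∀ i j : Fin N, i ≠ j → 2 * (R : ℝ) + 4 ≤ ‖x i - x j‖ := by
          intro i j hij
          have h1 : δ ≤ dist (as k • siteToE (x i)) (as k • siteToE (x j)) := hFs hy i j hij
          rw [dist_eq_norm] at h1
          have h2 := norm_smul_siteToE_sub_le hak.le (x i) (x j)
          have h3 : δ / (2 * as k) ≤ ‖x i - x j‖ := by
            rw [div_le_iff₀ (by positivity)]
            linarith
          exact hRδ.trans h3
        have hsep : ∀ i j : Fin N, i ≠ j → ∃ l : Fin 4,
            (2 * (R : ℤ) + 4) ≤ |((((x i l - x j l : ℤ) : ZMod (2 * Ls k + 1))).valMinAbs : ℤ)| := by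
          intro i j hij
          obtain ⟨l, hl⟩ := exists_valMinAbs_ge_of_norm_le x hwrap i j (hsepx i j hij)
          exact ⟨l, by exact_mod_cast hl⟩
        have hRa' : (R : ℝ) * a (βs k) ≤ ℓ₄ := by
          rw [← hunits k]
          exact hRa
        have h1 := H (βs k) hkβ (Ls k) N x R hR1 hRa' hRL hsep
        have h2 : C / (R : ℝ) ^ 4 ≤ C * κ ^ 4 * as k ^ 4 := by
          have h3 : ((R : ℝ)⁻¹) ^ 4 ≤ (as k * κ) ^ 4 :=
            pow_le_pow_left₀ (inv_nonneg.2 hRpos.le) hRinv' 4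
          calc C / (R : ℝ) ^ 4 = C * ((R : ℝ)⁻¹) ^ 4 := by rw [div_eq_mul_inv, inv_pow]
            _ ≤ C * (as k * κ) ^ 4 := mul_le_mul_of_nonneg_left h3 hC
            _ = C * κ ^ 4 * as k ^ 4 := by ring
        calc _ ≤ (C / (R : ℝ) ^ 4) ^ N := h1
          _ ≤ (C * κ ^ 4 * as k ^ 4) ^ N :=
              pow_le_pow_left₀ (div_nonneg hC (pow_nonneg hRpos.le 4)) h2 N
          _ = (C * κ ^ 4) ^ N * as k ^ (4 * N) := by rw [mul_pow, pow_mul]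
      -- sum over the torus
      rw [latticeDist_apply]
      refine (norm_sum_le _ _).trans ?_
      calc ∑ x ∈ Fintype.piFinset (fun _ : Fin N => box 4 (Ls k)),
            ‖((torusMoment r.ρ (βs k) (Ls k) r.curvature.F
                (wilsonTorusMean r.ρ (βs k) (Ls k) r.curvature.F) x : ℝ) : ℂ) *
              F (fun i => as k • siteToE (x i))‖
          ≤ ∑ x ∈ Fintype.piFinset (fun _ : Fin N => box 4 (Ls k)),
            (C * κ ^ 4) ^ N * as k ^ (4 * N) * ‖F (fun i => as k • siteToE (x i))‖ := by
            refine Finset.sum_le_sum fun x _ => ?_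
            rw [norm_mul, Complex.norm_real, Real.norm_eq_abs]
            by_cases hx : F (fun i => as k • siteToE (x i)) = 0
            · simp [hx]
            · exact mul_le_mul_of_nonneg_right (hW x hx) (norm_nonneg _)
        _ = (C * κ ^ 4) ^ N * (as k ^ (4 * N) *
            ∑ x ∈ Fintype.piFinset (fun _ : Fin N => box 4 (Ls k)), ‖F (fun i => as k • siteToE (x i))‖) := by
            rw [Finset.mul_sum, Finset.mul_sum]
            exact Finset.sum_congr rfl fun x _ => by ring
    exact le_of_tendsto_of_tendsto hlim (hRiem.const_mul _) hev

/-! ## The registered stub -/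

/-- **Registered stub `stub_uvExtract` (skeleton v3 of crux `ROT`, by name and signature): UV extraction.**  For every
compact simple `G`, every lattice representation `r` and every positive unit map `a → 0`, `MomentBounds6 G r a` implies
`UVCompactAt r a`: along every subsequence `φ → ∞` of every admissible scheme there are a strictly increasing `ψ` and a
one-field family `S₁` (`S₁ 0 = δ`, `S₁ 1 = 0`) with bounded densities off the diagonal such that the centred,
`a⁻⁴`-renormalised lattice `n`-point distributions of `tr F²` (`n ≥ 2`) converge to `S₁ n` on all of `⁰𝒮ₙ` along
`φ ∘ ψ`.  Composition of `momentBounds_of_momentBounds6`, `exists_subseq_latticeDist_limit` (after a tail shift into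
the regime `β ≥ β₄`, `a ≤ ℓ₄`; `a ≤ 1/24 ≤ 1` and the torus ranges come with the scheme) and
`offDiagDensity_of_tendsto_latticeDist`. [folklore; Glimm–Jaffe 1987 §6.1] -/
theorem stub_uvExtract : UVExtract := by
  intro G _ _ _ _ hG
  letI : MeasurableSpace G := borel G
  haveI : BorelSpace G := ⟨rfl⟩
  intro r a ha ha0 hMB6 sch hsch φ hφ
  classical
  obtain ⟨hunits, hβ, hranges⟩ := hsch
  obtain ⟨β₄, ℓ₄, K, hℓ₄, -, Hlim⟩ :=
    exists_subseq_latticeDist_limit r (momentBounds_of_momentBounds6 r a hMB6)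
  -- the scheme seen along `φ`: couplings `→ ∞`, units `→ 0`
  have hβφ : Tendsto (fun k => sch.β (φ k)) atTop atTop := hβ.comp hφ
  have haφ : Tendsto (fun k => a (sch.β (φ k))) atTop (𝓝 0) := ha0.comp hβφ
  -- a tail beyond which the regime of toolkit VI-c holds
  obtain ⟨k₀, hk₀⟩ : ∃ k₀ : ℕ, ∀ k, k₀ ≤ k → β₄ ≤ sch.β (φ k) ∧ a (sch.β (φ k)) ≤ ℓ₄ :=
    eventually_atTop.1 ((hβφ.eventually_ge_atTop β₄).and (haφ.eventually (eventually_le_nhds hℓ₄)))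
  have hreg_β : ∀ k, β₄ ≤ sch.β (φ (k + k₀)) := fun k => (hk₀ (k + k₀) (Nat.le_add_left _ _)).1
  have hreg_pos : ∀ k, 0 < a (sch.β (φ (k + k₀))) := fun k => ha _
  have hreg_1 : ∀ k, a (sch.β (φ (k + k₀))) ≤ 1 := fun k => by
    have h := (hranges (φ (k + k₀))).2.1
    rw [hunits] at h
    linarith
  have hreg_ℓ : ∀ k, a (sch.β (φ (k + k₀))) ≤ ℓ₄ := fun k => (hk₀ (k + k₀) (Nat.le_add_left _ _)).2
  have hreg_14 : ∀ k, 14 ≤ sch.L (φ (k + k₀)) := fun k => (hranges (φ (k + k₀))).2.2.1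
  have hreg_L : ∀ k, (a (sch.β (φ (k + k₀))))⁻¹ * (a (sch.β (φ (k + k₀))))⁻¹ ≤ sch.L (φ (k + k₀)) := fun k => by
    have h := (hranges (φ (k + k₀))).2.2.2
    rwa [hunits] at h
  obtain ⟨φ₁, hφ₁, S, -, hSconv⟩ := Hlim (fun k => sch.β (φ (k + k₀))) (fun k => sch.L (φ (k + k₀)))
    hreg_β hreg_pos hreg_1 hreg_ℓ hreg_14 hreg_L
  -- the further subsequence `ψ = φ₁ + k₀` and the limit family
  have hψ : StrictMono fun k => φ₁ k + k₀ := fun i j hij => Nat.add_lt_add_right (hφ₁ hij) k₀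
  obtain ⟨S₁, hS₁0, hS₁1, hS₁2⟩ : ∃ S₁ : SchwingerFamily E4, (∀ F, S₁ 0 F = F default) ∧ (∀ F, S₁ 1 F = 0) ∧
      ∀ n, 2 ≤ n → S₁ n = S n := by
    refine ⟨fun n => match n with
      | 0 => LabelledSchwingerFamily.evalAt (default : Fin 0 → E4)
      | 1 => 0
      | (m + 2) => S (m + 2), fun F => ?_, fun F => rfl, fun n hn => ?_⟩
    · exact LabelledSchwingerFamily.evalAt_apply _ _
    · obtain ⟨m, rfl⟩ : ∃ m, n = m + 2 := ⟨n - 2, by omega⟩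
      rfl
  refine ⟨fun k => φ₁ k + k₀, hψ, S₁, hS₁1, ?_, ?_⟩
  -- convergence on `⁰𝒮` along `φ ∘ ψ`, then the density bound along the same lattices
  · have hθ : Tendsto (fun k => φ (φ₁ k + k₀)) atTop atTop := hφ.comp hψ.tendsto_atTop
    have hconv : ∀ n, 2 ≤ n → ∀ F : 𝓢((Fin n → E4), ℂ), IsOffDiagonal F →
        Tendsto (fun k => latticeDist r.ρ (sch.β (φ (φ₁ k + k₀))) (sch.L (φ (φ₁ k + k₀)))
          (sch.a (φ (φ₁ k + k₀))) r.curvature.F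
          (wilsonTorusMean r.ρ (sch.β (φ (φ₁ k + k₀))) (sch.L (φ (φ₁ k + k₀))) r.curvature.F) n F)
          atTop (𝓝 (S₁ n F)) := by
      intro n hn F hF
      have h := hSconv n hn F hF
      rw [hS₁2 n hn]
      simp only [hunits]
      exact h
    exact offDiagDensity_of_tendsto_latticeDist r hMB6 (fun k => sch.a (φ (φ₁ k + k₀)))
      (fun k => sch.β (φ (φ₁ k + k₀))) (fun k => sch.L (φ (φ₁ k + k₀))) (fun k => hunits _) (hβ.comp hθ)
      (fun k => sch.a_pos _) (sch.tendsto_a.comp hθ) (sch.tendsto_L.comp hθ)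
      (fun k => ⟨(hranges _).2.2.1, (hranges _).2.2.2⟩) S₁ hS₁0 hS₁1 hconv
  · intro n hn F hF
    have h := hSconv n hn F hF
    rw [hS₁2 n hn]
    simp only [Function.comp_apply, hunits]
    exact h

end Summit.QuantumFields.YangMills.Theorems.ROT

end
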